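import Literature.Geometry.Kaehler.ComplexTorusHardLefschetzMinimalClassModPrimeKernel
import HarnessLib

/-!
# The Lefschetz forms `(x, y) ↦ ⟨x, γ ∧ y⟩` on `H²` are SYMMETRIC; for a constant type and `p ∣ g − 1` the image of
# `γ_{g−2} ∪ (−)` on `H²(X, ℤ/p)` is the annihilator of the polarisation: `γ_{g−2} ∧ H²(X, ℤ) + p·H^{2g−2}(X, ℤ) = {z : p ∣ ⟨θ/d₁, z⟩}`

Layer `Literature/Geometry/Kaehler`, namespace `Literature.Geometry.Kaehler.ComplexTorus`; lane `lit-hodgefound` (Track 2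
foundations library), seat p09, generation 41, row g41-#3. THEOREMS ONLY (0 definitions); no named fact, net debt 0. Sequel of
g41-#1 `ComplexTorusIntegralLefschetzFormsDiscriminant` (the Gram matrices `(⟨b_i, γ_{g−k} ∧ b_{i'}⟩)` and their discriminants) and g41-#2
`ComplexTorusHardLefschetzMinimalClassModPrimeKernel` (constant type: `[H^{2g−2} : γ_{g−2}∧H² + N·H^{2g−2}] = gcd(N, g−1)`; for `p ∣ g − 1`
the kernel of `γ_{g−2} ∪ (−)` on `H²(X, ℤ/p)` is the line of `θ`).

Sources (the statements being made precise over `ℤ` and `ℤ/p`):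

* Warner 1983, 2.6 (graded commutativity and associativity of the exterior product; the tree's `WedgeComm_holds`, `WedgeAssoc_holds`,
  `wedge_comm_of_even_left`, `wedge_wedge_comm_of_two`);
* Lange 2023 §6.2.4 (PDF p. 310: the cup-product pairing and Poincaré duality `Hᵖ(X, ℤ) ⥲ H^{2g−p}(X, ℤ)^*`); §5.4.1 Thm. 5.4.1 and (5.22)
  (PDF p. 275); §2.5.3 Thm. 2.5.16 / Cor. 2.5.17 (PDF p. 135); §4.2 (PDF p. 204); §1.5.1 (PDF p. 51: `θ/d₁ ∈ H²(X, ℤ)`); §1.1.3 Lemma 1.1.17;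
* Voisin 2002 §6.2.3 Thm. 6.25 (PDF p. 125), §6.3.2 (the Lefschetz / Hodge–Riemann form `(α, β) ↦ ∫ L^{n−k} α ∧ β`, symmetric for `k` even)
  and §7.1.2 (PDF p. 134 L31); Benoist–Debarre 2023 §1 (p. 3).

## Contents (`g = j + 2`, `θ = ofRealForm η`, symplectic enumeration `e₀` of type `d₁ ∣ ⋯ ∣ d_g`, minimal class `γ = γ_{g−2}`,
## `θ^{∧(g−2)} = ((g−2)!·d₁⋯d_{g−2})·γ`; `H² = H²(X, ℤ)`, `H = H^{2g−2}(X, ℤ)`, `S = γ ∧ H²`, `θ' = θ/d₁`)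

* §1 (ANY `E`, any even-degree `γ`) **`x ∧ (γ ∧ y) = y ∧ (γ ∧ x)`** for `2`-forms `x, y` (`wedge_wedge_eq_wedge_wedge_of_two`), hence
  **`⟨x, γ ∧ y⟩ = ⟨y, γ ∧ x⟩`** for every orientation (`poincarePairing_wedge_comm_of_two`): the Lefschetz forms of degree two of g41-#1 are
  SYMMETRIC, and so are their Gram matrices (`isSymm_of_eq_poincarePairing_wedge_two`).
* §2 CONSTANT TYPE, `p` prime, `p ∣ g − 1`: `⟨θ', γ ∧ x⟩ = (g−1)·⟨x, γ_{g−1}⟩ ∈ p·ℤ` for `x ∈ H²` (§1 and `γ ∧ θ' = (g−1)·γ_{g−1}`, g41-#2), so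
  `S + p·H ⊆ W := {z ∈ H : p ∣ ⟨θ', z⟩}`; `W ≠ H` (Poincaré duality over `ℤ` gives `z ∈ H` with `⟨θ', z⟩ = θ'(λ₁, μ₁) = 1`) and `[H : S + pH] = p`
  (g41-#2) force **`γ_{g−2} ∧ H²(X, ℤ) + p·H^{2g−2}(X, ℤ) = {z ∈ H^{2g−2}(X, ℤ) : p ∣ ⟨θ/d₁, z⟩}`**
  (`IsSymplecticEnum.map_wedge_integralForms_two_sup_map_nsmul_eq_inf_comap_of_forall_eq`, membership form `…mem_sup_map_nsmul_iff…`):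
  together with g41-#2, for a principally polarised `X` of dimension `g ≥ 3` and `p ∣ g − 1`,
  **`ker (θ^{g−2}/(g−2)! ∪) = 𝔽_p·θ̄ ⊂ H²(X, 𝔽_p)` and `im (θ^{g−2}/(g−2)! ∪) = θ̄^⊥ ⊂ H^{2g−2}(X, 𝔽_p)`** (annihilator under Poincaré duality mod `p`).

## References

* [cite: WarnerGTM94, 2.6]
* [cite: Lange2023AbelianVarietiesComplex, §6.2.4 (PDF p. 310); §5.4.1 Thm. 5.4.1 and (5.22) (PDF p. 275); §2.5.3 Thm. 2.5.16 and Cor. 2.5.17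
  (PDF p. 135); §4.2 (PDF p. 204); §1.5.1 (PDF p. 51); §1.1.3 Lemma 1.1.17; §2.1.1]
* [cite: VoisinHodgeI2002, §6.2.3 Thm. 6.25 (PDF p. 125); §6.3.2; §7.1.2 (PDF p. 134 L31)]
* [cite: BenoistDebarre2023SmoothSubvarietiesJacobians, §1 (p. 3)]
-/

noncomputable section

open Module Function
open Literature.LinearAlgebra.Alternating

namespace Literature.Geometry.Kaehler.ComplexTorus

/-! ## §1 The Lefschetz forms of degree two are symmetric -/

section Symmetric

variable {E : Type*} [NormedAddCommGroup E] [NormedSpace ℂ E]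

/-- **`x ∧ (γ ∧ y) = y ∧ (γ ∧ x)` for `2`-forms `x, y` and a form `γ` of even degree `2j`** — graded commutativity (`γ ∧ y = y ∧ γ`,
`x ∧ y = y ∧ x` up to reindexing) and associativity of the exterior product (the tree's `wedge_comm_of_even_left`, `wedge_wedge_comm_of_two`).
[cite: WarnerGTM94, 2.6] -/
theorem wedge_wedge_eq_wedge_wedge_of_two {j : ℕ} (x y : E [⋀^Fin 2]→L[ℝ] ℂ) (γ : E [⋀^Fin (2 * j)]→L[ℝ] ℂ) :
    x.wedge (γ.wedge y) = y.wedge (γ.wedge x) := by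
  have hγy : γ.wedge y = (y.wedge γ).domDomCongr (finCongr (Nat.add_comm 2 (2 * j))) := by
    rw [wedge_comm_of_even_left γ y, domDomCongr_finCongr_trans, domDomCongr_finCongr_self]
  have hγx : γ.wedge x = (x.wedge γ).domDomCongr (finCongr (Nat.add_comm 2 (2 * j))) := by
    rw [wedge_comm_of_even_left γ x, domDomCongr_finCongr_trans, domDomCongr_finCongr_self]
  rw [hγy, hγx, wedge_domDomCongr_finCongr, wedge_domDomCongr_finCongr, wedge_wedge_comm_of_two x y γ]

variable {ι : Type*} [Fintype ι] [DecidableEq ι] (Φ : (ι → ℝ) ≃L[ℝ] E) {n j : ℕ}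

omit [Fintype ι] in
/-- **The Lefschetz form `(x, y) ↦ ⟨x, γ ∧ y⟩` on `2`-forms is SYMMETRIC** for every form `γ` of even degree `2j` and every orientation `e` of a
lattice basis of `X = E/Φ(ℤ^ι)` (`2 + (2j + 2) = n`): `⟨x, γ ∧ y⟩ = ⟨y, γ ∧ x⟩` — for `γ = L^{g−2}` this is the symmetry of the Lefschetz /
Hodge–Riemann form `∫ θ^{g−2} ∧ x ∧ y` on `H²`. [cite: WarnerGTM94, 2.6] [cite: VoisinHodgeI2002, §6.3.2] [cite: Lange2023AbelianVarietiesComplex, §6.2.4 (PDF p. 310)] -/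
theorem poincarePairing_wedge_comm_of_two (e : Fin n ≃ ι) (hn : 2 + (2 * j + 2) = n) (γ : E [⋀^Fin (2 * j)]→L[ℝ] ℂ)
    (x y : E [⋀^Fin 2]→L[ℝ] ℂ) :
    poincarePairing Φ e hn x (γ.wedge y) = poincarePairing Φ e hn y (γ.wedge x) := by
  rw [poincarePairing_apply, poincarePairing_apply, wedge_wedge_eq_wedge_wedge_of_two x y γ]

omit [Fintype ι] in
/-- **The Gram matrix of the Lefschetz form of degree two is symmetric**: any (integer) matrix `G` with `G_{ii'} = ⟨b_i, γ ∧ b_{i'}⟩` on a family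
`b` of `2`-forms is symmetric (g41-#1's `G` on a `ℤ`-basis of `H²(X, ℤ)`). [cite: WarnerGTM94, 2.6] [cite: VoisinHodgeI2002, §6.3.2] [cite: Lange2023AbelianVarietiesComplex, §6.2.4 (PDF p. 310)] -/
theorem isSymm_of_eq_poincarePairing_wedge_two (e : Fin n ≃ ι) (hn : 2 + (2 * j + 2) = n) (γ : E [⋀^Fin (2 * j)]→L[ℝ] ℂ)
    {m : Type*} (b : m → E [⋀^Fin 2]→L[ℝ] ℂ) (G : Matrix m m ℤ)
    (hG : ∀ i i', (G i i' : ℂ) = poincarePairing Φ e hn (b i) (γ.wedge (b i'))) : G.IsSymm := by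
  ext i i'
  apply Int.cast_injective (α := ℂ)
  rw [Matrix.transpose_apply, hG, hG, poincarePairing_wedge_comm_of_two]

end Symmetric

/-! ## §2 Constant type, `p ∣ g − 1`: the image of `γ_{g−2} ∪ (−)` on `H²(X, ℤ/p)` is the annihilator of `θ` -/

section ModPrimeImage

variable {ι : Type*} [Fintype ι] [DecidableEq ι] {E : Type*} [NormedAddCommGroup E] [NormedSpace ℂ E]
  (Φ : (ι → ℝ) ≃L[ℝ] E) {j n : ℕ} {e₀ : Fin (j + 2) ⊕ Fin (j + 2) ≃ ι} {η : E [⋀^Fin 2]→L[ℝ] ℝ} {d : Fin (j + 2) → ℕ}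

omit [Fintype ι] in
/-- Evaluation of integral `2`-classes on a pair of lattice basis vectors, as an additive map `H²(X, ℤ) → ℤ`.
[cite: Lange2023AbelianVarietiesComplex, §1.1.3 Lemma 1.1.17] -/
private theorem exists_addMonoidHom_apply_pair₄₄ (a b : ι) :
    ∃ g : ↥(integralForms Φ 2) →+ ℤ, ∀ x : integralForms Φ 2,
      (g x : ℂ) = (x : E [⋀^Fin 2]→L[ℝ] ℂ) ![Φ (Pi.single a 1), Φ (Pi.single b 1)] := by
  choose z hz using fun x : ↥(integralForms Φ 2) ↦ exists_int_apply_pair_of_mem_integralForms_two Φ x.2 a b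
  refine ⟨AddMonoidHom.mk' z fun x y ↦ ?_, fun x ↦ (hz x).symm⟩
  apply Int.cast_injective (α := ℂ)
  rw [Int.cast_add, ← hz, ← hz, ← hz, AddSubgroup.coe_add, ContinuousAlternatingMap.add_apply]

/-- **`⟨θ/d₁, γ_{g−2} ∧ x⟩ = (g−1) · ⟨x, γ_{g−1}⟩` for a constant type** (`g = j + 2`, `x` any `2`-form): the symmetry of §1 and
`γ_{g−2} ∧ θ/d₁ = (g−1)·γ_{g−1}` (g41-#2). [cite: Lange2023AbelianVarietiesComplex, §2.5.3 Thm. 2.5.16 and Cor. 2.5.17 (PDF p. 135); §6.2.4 (PDF p. 310); §1.5.1 (PDF p. 51)] [cite: WarnerGTM94, 2.6] -/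
theorem IsSymplecticEnum.poincarePairing_inv_smul_ofRealForm_wedge_of_forall_eq (h : IsSymplecticEnum Φ e₀ η d)
    (hη : IsRiemannForm Φ η) (hle : j ≤ j + 2) {γ : E [⋀^Fin (2 * j)]→L[ℝ] ℂ}
    (hγ : wedgePow (ofRealForm η) j = ((j.factorial * ∏ i : Fin j, d (Fin.castLE hle i) : ℕ) : ℂ) • γ) (hd : ∀ i, d i = d 0)
    (hle₁ : j + 1 ≤ j + 2) {m : E [⋀^Fin (2 * j + 2)]→L[ℝ] ℂ}
    (hm : wedgePow (ofRealForm η) (j + 1) = (((j + 1).factorial * ∏ i : Fin (j + 1), d (Fin.castLE hle₁ i) : ℕ) : ℂ) • m)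
    (e : Fin n ≃ ι) (hn : 2 + (2 * j + 2) = n) (x : E [⋀^Fin 2]→L[ℝ] ℂ) :
    poincarePairing Φ e hn ((((d 0 : ℕ) : ℂ))⁻¹ • ofRealForm η) (γ.wedge x) = (j + 1) • poincarePairing Φ e hn x m := by
  rw [poincarePairing_wedge_comm_of_two, h.wedge_inv_smul_ofRealForm_eq_nsmul_of_forall_eq Φ hη hle hγ hd hle₁ hm, map_nsmul]

/-- **Constant type, `p` prime, `p ∣ g − 1`: the image of `γ_{g−2} ∪ (−)` on `H²(X, ℤ/p)` is the annihilator of the polarisation** (`g = j + 2`):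

  `γ_{g−2} ∧ H²(X, ℤ) + p·H^{2g−2}(X, ℤ) = {z ∈ H^{2g−2}(X, ℤ) : p ∣ ⟨θ/d₁, z⟩}`,

i.e. `im (γ_{g−2} ∪) = θ̄^⊥ ⊂ H^{2g−2}(X, 𝔽_p)` under the (perfect) Poincaré pairing modulo `p`. (`⊆`: `⟨θ/d₁, γ∧x⟩ = (g−1)·⟨x, γ_{g−1}⟩` and
`⟨θ/d₁, p·y⟩ = p·⟨θ/d₁, y⟩`; `⊇`: the right side is a proper subgroup — Poincaré duality over `ℤ` produces `z` with `⟨θ/d₁, z⟩ = θ/d₁(λ₁, μ₁) = 1`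
— containing the left side, which has prime index `[H^{2g−2} : γ∧H² + pH^{2g−2}] = gcd(p, g−1) = p` (g41-#2).)
[cite: Lange2023AbelianVarietiesComplex, §6.2.4 (PDF p. 310); §5.4.1 Thm. 5.4.1 and (5.22) (PDF p. 275); §2.5.3 Cor. 2.5.17 (PDF p. 135); §4.2 (PDF p. 204); §1.5.1 (PDF p. 51); §2.1.1] [cite: VoisinHodgeI2002, §6.3.2; §7.1.2 (PDF p. 134 L31)] [cite: BenoistDebarre2023SmoothSubvarietiesJacobians, §1 (p. 3)] -/
theorem IsSymplecticEnum.map_wedge_integralForms_two_sup_map_nsmul_eq_inf_comap_of_forall_eq (h : IsSymplecticEnum Φ e₀ η d)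
    (hη : IsRiemannForm Φ η) (hle : j ≤ j + 2) {γ : E [⋀^Fin (2 * j)]→L[ℝ] ℂ}
    (hγ : wedgePow (ofRealForm η) j = ((j.factorial * ∏ i : Fin j, d (Fin.castLE hle i) : ℕ) : ℂ) • γ) (hd : ∀ i, d i = d 0)
    {p : ℕ} (hp : p.Prime) (hpj : p ∣ j + 1) (e : Fin n ≃ ι) (hn : 2 + (2 * j + 2) = n) :
    (integralForms Φ 2).map (AddMonoidHom.mk' (fun x : E [⋀^Fin 2]→L[ℝ] ℂ ↦ γ.wedge x) (ContinuousAlternatingMap.wedge_add_right _)) ⊔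
        (integralForms Φ (2 * j + 2)).map (nsmulAddMonoidHom p) =
      integralForms Φ (2 * j + 2) ⊓ (AddSubgroup.zmultiples (p : ℂ)).comap
        (poincarePairing Φ e hn ((((d 0 : ℕ) : ℂ))⁻¹ • ofRealForm η)).toAddMonoidHom := by
  classical
  have hle₁ : j + 1 ≤ j + 2 := by omega
  obtain ⟨m, hmH, hm⟩ : ∃ m ∈ integralForms Φ (2 * j + 2), wedgePow (ofRealForm η) (j + 1) =
      (((j + 1).factorial * ∏ i : Fin (j + 1), d (Fin.castLE hle₁ i) : ℕ) : ℂ) • m :=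
    h.exists_mem_integralForms_wedgePow_eq_content_smul Φ hle₁
  have hc := h.relIndex_map_wedge_integralForms_two_sup_map_nsmul_of_forall_eq Φ hη hle hγ hd p
  rw [Nat.gcd_eq_left hpj] at hc
  have hsym := h.poincarePairing_inv_smul_ofRealForm_wedge_of_forall_eq Φ hη hle hγ hd hle₁ hm e hn
  have hθ'Z := h.inv_smul_ofRealForm_mem_integralForms_two Φ hη
  have hSH := h.map_wedge_integralForms_two_le_of_eq_content_smul Φ hη hle hγ
  set L : (E [⋀^Fin 2]→L[ℝ] ℂ) →+ (E [⋀^Fin (2 * j + 2)]→L[ℝ] ℂ) := AddMonoidHom.mk'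
    (fun x : E [⋀^Fin 2]→L[ℝ] ℂ ↦ γ.wedge x) (ContinuousAlternatingMap.wedge_add_right _) with hL
  set H₂ := integralForms Φ 2 with hH₂
  set H := integralForms Φ (2 * j + 2) with hH
  set S := H₂.map L with hS
  set pH := H.map (nsmulAddMonoidHom p) with hpH
  set θ' : E [⋀^Fin 2]→L[ℝ] ℂ := (((d 0 : ℕ) : ℂ))⁻¹ • ofRealForm η with hθ'
  set W := H ⊓ (AddSubgroup.zmultiples (p : ℂ)).comap (poincarePairing Φ e hn θ').toAddMonoidHom with hW
  have hd0 : ((d 0 : ℕ) : ℂ) ≠ 0 := by exact_mod_cast (h.pos hη 0).ne'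
  have hpHH : pH ≤ H := by
    rintro _ ⟨x, hx, rfl⟩
    exact H.nsmul_mem hx p
  obtain ⟨c, hc'⟩ := hpj
  -- `⊆`
  have hle' : S ⊔ pH ≤ W := by
    refine sup_le ?_ ?_
    · rintro _ ⟨x, hx, rfl⟩
      refine AddSubgroup.mem_inf.2 ⟨hSH ⟨x, hx, rfl⟩, ?_⟩
      obtain ⟨z, hz⟩ := poincarePairing_mem_range_int Φ e hn hx hmH
      rw [AddSubgroup.mem_comap, LinearMap.toAddMonoidHom_coe, hL, AddMonoidHom.mk'_apply, hsym, hz, hc']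
      refine AddSubgroup.mem_zmultiples_iff.2 ⟨c * z, ?_⟩
      simp only [zsmul_eq_mul, nsmul_eq_mul]
      push_cast
      ring
    · rintro _ ⟨y, hy, rfl⟩
      refine AddSubgroup.mem_inf.2 ⟨H.nsmul_mem hy p, ?_⟩
      obtain ⟨z, hz⟩ := poincarePairing_mem_range_int Φ e hn hθ'Z hy
      rw [AddSubgroup.mem_comap, LinearMap.toAddMonoidHom_coe, nsmulAddMonoidHom_apply, map_nsmul, hz]
      refine AddSubgroup.mem_zmultiples_iff.2 ⟨z, ?_⟩
      simp only [zsmul_eq_mul, nsmul_eq_mul]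
      ring
  -- a class `δ ∈ H` with `⟨θ', δ⟩ = 1`, so `W ≠ H`
  obtain ⟨g, hg⟩ := exists_addMonoidHom_apply_pair₄₄ Φ (e₀ (Sum.inl 0)) (e₀ (Sum.inr 0))
  obtain ⟨δ, hδ, -⟩ := existsUnique_integral_poincarePairing_eq' Φ e hn g
  have hθ'1 : θ' ![Φ (Pi.single (e₀ (Sum.inl 0)) 1), Φ (Pi.single (e₀ (Sum.inr 0)) 1)] = 1 := by
    rw [hθ', ContinuousAlternatingMap.smul_apply, h.ofRealForm_apply_pair Φ, smul_eq_mul, inv_mul_cancel₀ hd0]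
  have hδ1 : poincarePairing Φ e hn θ' δ = 1 := by
    rw [hδ ⟨θ', hθ'Z⟩, hg, hθ'1]
  have hδW : (δ : E [⋀^Fin (2 * j + 2)]→L[ℝ] ℂ) ∉ W := fun hmem ↦ by
    have h1 := (AddSubgroup.mem_inf.1 hmem).2
    rw [AddSubgroup.mem_comap, LinearMap.toAddMonoidHom_coe, hδ1] at h1
    obtain ⟨k, hk⟩ := AddSubgroup.mem_zmultiples_iff.1 h1
    rw [zsmul_eq_mul] at hk
    have hk' : (k * p : ℤ) = 1 := by exact_mod_cast hk
    exact hp.ne_one (Nat.cast_eq_one.1 (Int.eq_one_of_mul_eq_one_left (Int.natCast_nonneg p) hk'))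
  have hWH : W ≤ H := inf_le_left
  have hWne : W.relIndex H ≠ 1 := fun h1 ↦ hδW (AddSubgroup.relIndex_eq_one.1 h1 δ.2)
  -- index sandwich: `[H : S + pH] = p` is prime
  have hmul := AddSubgroup.relIndex_mul_relIndex (S ⊔ pH) W H hle' hWH
  rw [hc] at hmul
  have hdvd : W.relIndex H ∣ p := Dvd.intro_left _ hmul
  rcases (Nat.dvd_prime hp).1 hdvd with h1 | h1
  · exact absurd h1 hWne
  rw [h1] at hmul
  have h2 : (S ⊔ pH).relIndex W = 1 := Nat.eq_of_mul_eq_mul_right hp.pos (hmul.trans (one_mul p).symm)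
  exact le_antisymm hle' (AddSubgroup.relIndex_eq_one.1 h2)

/-- **Membership form** (constant type, `p` prime, `p ∣ g − 1`, `g = j + 2`): an integral class `z ∈ H^{2g−2}(X, ℤ)` is of the form
`γ_{g−2} ∧ x + p·y` (`x ∈ H²(X, ℤ)`, `y ∈ H^{2g−2}(X, ℤ)`) iff `p ∣ ⟨θ/d₁, z⟩`. [cite: Lange2023AbelianVarietiesComplex, §6.2.4 (PDF p. 310); §5.4.1 (5.22) (PDF p. 275); §1.5.1 (PDF p. 51); §2.1.1] [cite: VoisinHodgeI2002, §7.1.2 (PDF p. 134 L31)] -/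
theorem IsSymplecticEnum.mem_map_wedge_integralForms_two_sup_map_nsmul_iff_of_forall_eq (h : IsSymplecticEnum Φ e₀ η d)
    (hη : IsRiemannForm Φ η) (hle : j ≤ j + 2) {γ : E [⋀^Fin (2 * j)]→L[ℝ] ℂ}
    (hγ : wedgePow (ofRealForm η) j = ((j.factorial * ∏ i : Fin j, d (Fin.castLE hle i) : ℕ) : ℂ) • γ) (hd : ∀ i, d i = d 0)
    {p : ℕ} (hp : p.Prime) (hpj : p ∣ j + 1) (e : Fin n ≃ ι) (hn : 2 + (2 * j + 2) = n) {z : E [⋀^Fin (2 * j + 2)]→L[ℝ] ℂ}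
    (hz : z ∈ integralForms Φ (2 * j + 2)) :
    z ∈ (integralForms Φ 2).map (AddMonoidHom.mk' (fun x : E [⋀^Fin 2]→L[ℝ] ℂ ↦ γ.wedge x) (ContinuousAlternatingMap.wedge_add_right _)) ⊔
        (integralForms Φ (2 * j + 2)).map (nsmulAddMonoidHom p) ↔
      ∃ c : ℤ, poincarePairing Φ e hn ((((d 0 : ℕ) : ℂ))⁻¹ • ofRealForm η) z = c * p := by
  rw [h.map_wedge_integralForms_two_sup_map_nsmul_eq_inf_comap_of_forall_eq Φ hη hle hγ hd hp hpj e hn, AddSubgroup.mem_inf,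
    AddSubgroup.mem_comap, LinearMap.toAddMonoidHom_coe, AddSubgroup.mem_zmultiples_iff]
  simp only [zsmul_eq_mul, eq_comm]
  exact ⟨fun h1 ↦ h1.2, fun h1 ↦ ⟨hz, h1⟩⟩

/-- **Existence form, constant type, `p ∣ g − 1`** (symplectic presentation): the integral minimal class `γ_{g−2}` exists and the image of
`γ_{g−2} ∪ (−)` modulo `p` is the annihilator of `θ/d₁`. [cite: Lange2023AbelianVarietiesComplex, §2.5.3 Thm. 2.5.16 and Cor. 2.5.17 (PDF p. 135); §5.4.1 (5.22) (PDF p. 275); §2.1.1] [cite: BenoistDebarre2023SmoothSubvarietiesJacobians, §1 (p. 3)] -/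
theorem IsSymplecticEnum.exists_minimalClass_map_wedge_integralForms_two_sup_map_nsmul_eq_inf_comap (h : IsSymplecticEnum Φ e₀ η d)
    (hη : IsRiemannForm Φ η) (hle : j ≤ j + 2) (hd : ∀ i, d i = d 0) {p : ℕ} (hp : p.Prime) (hpj : p ∣ j + 1)
    (e : Fin n ≃ ι) (hn : 2 + (2 * j + 2) = n) :
    ∃ γ ∈ integralForms Φ (2 * j), wedgePow (ofRealForm η) j = ((j.factorial * ∏ i : Fin j, d (Fin.castLE hle i) : ℕ) : ℂ) • γ ∧
      (integralForms Φ 2).map (AddMonoidHom.mk' (fun x : E [⋀^Fin 2]→L[ℝ] ℂ ↦ γ.wedge x) (ContinuousAlternatingMap.wedge_add_right _)) ⊔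
          (integralForms Φ (2 * j + 2)).map (nsmulAddMonoidHom p) =
        integralForms Φ (2 * j + 2) ⊓ (AddSubgroup.zmultiples (p : ℂ)).comap
          (poincarePairing Φ e hn ((((d 0 : ℕ) : ℂ))⁻¹ • ofRealForm η)).toAddMonoidHom := by
  obtain ⟨γ, hγZ, hγ⟩ := h.exists_mem_integralForms_wedgePow_eq_content_smul Φ hle
  exact ⟨γ, hγZ, hγ, h.map_wedge_integralForms_two_sup_map_nsmul_eq_inf_comap_of_forall_eq Φ hη hle hγ hd hp hpj e hn⟩

end ModPrimeImage

end Literature.Geometry.Kaehler.ComplexTorus
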